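import Literature.Barriers.ValiantsHypothesis.CT23ExplicitMatrixPowering
import Literature.Barriers.ValiantsHypothesis.CT23ExplicitDeterminantABP
import HarnessLib

/-!
# The determinant of an explicitly encoded matrix by a small circuit with projection gates
# (Chatterjee–Tengse arXiv:2309.07612, Prop. "Computing determinant of explicit matrices" =
# v2 Prop. 2.29 / v1 Prop. 36, assembled from its two Claims; val-lit t24 g9, X-CT23 engine glue
# E-d ∘ E-c′)

Theorem-only (plus two plumbing `def`s) companion of `CT23ExplicitMatrixPowering.lean` (brick
E-c′: iterated squaring `powPoly / powCircuit`, `matOf_powPoly`) and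
`CT23ExplicitDeterminantABP.lean` (brick E-d: the explicit Mahajan–Vinay program,
`matOf_mvEdge_pow_apply_src_snk`, `exists_projCircuit_mvEdge`); NO named facts. Honest framing:
consequences-side literature infrastructure (one step of the engine behind `CT23_thm_3_1`); it
discharges nothing by itself; `VP ≠ VNP` is NOT proved and nothing here bears on it.

## The printed statement (v1 Prop. 36, held text `paper:arxiv-2309.07612` p0012.txt:L17–L20)

"Let `M ∈ F^{N × N}` be a matrix that is encoded by a circuit `C(x, a, b)` with
`|a| = |b| = log N`. Then `det(M)` can be computed by a circuit `C'` with projection gates, of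
size `O(size(C) + log² N)`. Moreover, if `C` is constant-free, then so is `C'`." Proof (ibid.
L21–L28 and the two Claims): explicit ABP (Claim 37) + repeated squaring (Claim 38),
"`C'(x) = D_k(x, s, t)`".

## Rendering

`M = matOf r c E` (`N = 2^L`, `0 < L`), `C` a fan-in-two `ProjCircuit` computing `E` whose
projection gates bind none of the index blocks `r, c`, the label blocks `U, V`, or the squaring
workspace `ws, zs` (`K ≥ L` levels); all these blocks and two scratch names `μ₁, μ₂` pairwise
distinct (`DetSupply`, one injective map), and `E` mentioning none of `U, V, ws, zs`; `C` may use
ARBITRARY constants. Then (`exists_projCircuit_det_matOf_general`) there is a fan-in-two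
`ProjCircuit` `Q` computing the polynomial `det (matOf r c E)`, of size
`≤ 2·size(C) + (145·L² + 256·L + 49)` — the printed `O(size(C) + log² N)` — projecting only `C`'s
variables and the workspace, AND (the printed "moreover", as the implication
`C.HasSignConstants → Q.HasSignConstants`) constant-free whenever `C` is;
`exists_projCircuit_det_matOf` is the constant-free corollary (the first accepted statement, which
took `C.HasSignConstants` as a HYPOTHESIS — ERRATUM val-lit t24 g10, referee rows np 1357 / 1370:
the general theorem is the correction, same construction). Route: brick E-d's encoder circuit for
`Ĉ` (`exists_projCircuit_mvEdge_general`, `2·|C| + 112L² + 253L + 49`), `L` squaring levels of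
brick E-c′ on `3L`-bit labels (`+ L·(33L + 3)`), then the bits of the source and sink labels
SUBSTITUTED for the free label inputs (brick E-a's `ProjCircuit.subst` with constant operands
`0/1`; no new gate), and `D_L(x, s, t) = det` by `matOf_powPoly` and
`matOf_mvEdge_pow_apply_src_snk`.

## Main declarations (namespace `Literature.Barriers.ValiantsHypothesis`)

* `DetSupply r c U V ws zs μ₁ μ₂` (one injective map) with projections `DetSupply.mvFresh`,
  `DetSupply.supply`, `DetSupply.μ_ne`, `DetSupply.U_ne_μ`, `DetSupply.V_ne_μ`.
* `bitOps`, `bitOps_eval`, `bitOps_hasSignConstants`, `substCompat_labSubst`: substituting the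
  bits of two labels for the free label inputs of a projection circuit.
* **`labSubst_powPoly_mvEdge`**: `D_L(x, s, t) = det (matOf r c E)`.
* **`exists_projCircuit_det_matOf_general`**: Prop. 2.29 as a theorem (any constants, with the
  constant-free "moreover"); `exists_projCircuit_det_matOf`: its constant-free corollary.

## References

* [ChatterjeeTengse2023] P. Chatterjee, A. Tengse, *Lower Bounds from Succinct Hitting Sets*,
  arXiv:2309.07612; v2 Prop. 2.29 with Claims 2.30/2.31 (v1: Prop. 36, Claims 37/38; held text
  p0012.txt:L17–L80, p0013.txt:L1–L28).
-/

noncomputable section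

open MvPolynomial

namespace Literature.Barriers.ValiantsHypothesis

open Literature.Computability.AlgebraicComplexity

universe u v

variable {k : Type u} [CommRing k] {τ : Type v} [DecidableEq τ] {L K : ℕ}

/-! ### One supply of pairwise distinct variables for the whole construction -/

/-- **All the variable blocks of the construction are pairwise distinct** (one injective map): the
encoder's index blocks `r, c`, the label blocks `U, V`, the squaring workspace `ws, zs`
(`K` levels) and the two scratch names `μ₁, μ₂`.
[cite: ChatterjeeTengse2023, Prop. 2.29 with Claims 2.30–2.31 (v1: Prop. 36; p0012.txt:L49–L51, p0013.txt:L18–L21)] -/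
structure DetSupply (r c : Fin L → τ) (U V : Fin (3 * L) → τ) (ws : Fin K → Fin (3 * L) → τ)
    (zs : Fin K → τ) (μ₁ μ₂ : τ) : Prop where
  /-- all of `r, c, U, V, ws i l, zs i, μ₁, μ₂` are pairwise distinct variables -/
  inj : Function.Injective
    (Sum.elim (Sum.elim (Sum.elim r c) (Sum.elim U V))
      (Sum.elim (Sum.elim (fun p : Fin K × Fin (3 * L) => ws p.1 p.2) zs)
        (fun b : Bool => if b then μ₁ else μ₂)))

namespace DetSupply

variable {r c : Fin L → τ} {U V : Fin (3 * L) → τ} {ws : Fin K → Fin (3 * L) → τ} {zs : Fin K → τ}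
  {μ₁ μ₂ : τ} (D : DetSupply r c U V ws zs μ₁ μ₂)
include D

omit [DecidableEq τ] in
/-- The encoder/label part is `MVFresh`. [cite: ChatterjeeTengse2023, Claim 2.30 (v1: Claim 37; p0012.txt:L49–L51)] -/
theorem mvFresh : MVFresh r c U V :=
  ⟨fun _ _ h => Sum.inl_injective (D.inj (show _ = _ from h))⟩

omit [DecidableEq τ] in
/-- The label/workspace part is a `Supply`. [cite: ChatterjeeTengse2023, Claim 2.31 (v1: Claim 38; p0013.txt:L18–L21)] -/
theorem supply : Supply U V ws zs := by
  refine ⟨fun x y h => ?_⟩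
  let φ : (Fin (3 * L) ⊕ Fin (3 * L)) ⊕ (Fin K × Fin (3 * L) ⊕ Fin K) →
      ((Fin L ⊕ Fin L) ⊕ (Fin (3 * L) ⊕ Fin (3 * L))) ⊕ ((Fin K × Fin (3 * L) ⊕ Fin K) ⊕ Bool) :=
    Sum.elim (fun z => Sum.inl (Sum.inr z)) (fun z => Sum.inr (Sum.inl z))
  have hφ : Function.Injective φ := by
    rintro (x | x) (y | y) h <;> simp [φ] at h ⊢ <;> exact h
  have key : ∀ z, Sum.elim (Sum.elim U V) (Sum.elim (fun p : Fin K × Fin (3 * L) => ws p.1 p.2) zs) z =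
      Sum.elim (Sum.elim (Sum.elim r c) (Sum.elim U V))
        (Sum.elim (Sum.elim (fun p : Fin K × Fin (3 * L) => ws p.1 p.2) zs)
          (fun b : Bool => if b then μ₁ else μ₂)) (φ z) := by
    rintro ((l | l) | (l | l)) <;> rfl
  rw [key, key] at h
  exact hφ (D.inj h)

omit [DecidableEq τ] in
/-- The scratch names are distinct. [cite: ChatterjeeTengse2023, Claim 2.30 (v1: Claim 37; p0012.txt:L53–L57)] -/
theorem μ_ne : μ₁ ≠ μ₂ := fun h => by
  have := @D.inj (Sum.inr (Sum.inr true)) (Sum.inr (Sum.inr false)) (by simpa using h)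
  simp at this

omit [DecidableEq τ] in
/-- `U` misses the scratch names. [cite: ChatterjeeTengse2023, Claim 2.30 (v1: Claim 37; p0012.txt:L53–L57)] -/
theorem U_ne_μ (l : Fin (3 * L)) : U l ≠ μ₁ ∧ U l ≠ μ₂ := by
  refine ⟨fun h => ?_, fun h => ?_⟩
  · have := @D.inj (Sum.inl (Sum.inr (Sum.inl l))) (Sum.inr (Sum.inr true)) (by simpa using h)
    simp at this
  · have := @D.inj (Sum.inl (Sum.inr (Sum.inl l))) (Sum.inr (Sum.inr false)) (by simpa using h)
    simp at this

omit [DecidableEq τ] in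
/-- `V` misses the scratch names. [cite: ChatterjeeTengse2023, Claim 2.30 (v1: Claim 37; p0012.txt:L53–L57)] -/
theorem V_ne_μ (l : Fin (3 * L)) : V l ≠ μ₁ ∧ V l ≠ μ₂ := by
  refine ⟨fun h => ?_, fun h => ?_⟩
  · have := @D.inj (Sum.inl (Sum.inr (Sum.inr l))) (Sum.inr (Sum.inr true)) (by simpa using h)
    simp at this
  · have := @D.inj (Sum.inl (Sum.inr (Sum.inr l))) (Sum.inr (Sum.inr false)) (by simpa using h)
    simp at this

end DetSupply

/-! ### Substituting the bits of two labels for the free label inputs -/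

variable (U V : Fin (3 * L) → τ)

/-- Constant operands `0/1` for the label inputs: the bits of `s` for `U`, of `t` for `V`
("`C'(x) = D_k(x, s, t)`"). [cite: ChatterjeeTengse2023, Claim 2.31 (v1: Claim 38; p0013.txt:L26)] -/
def bitOps (s t : Fin (3 * L) → Bool) : τ → ArithCircuit.Operand k τ :=
  onBlock U (fun l => .const (if s l then 1 else 0))
    (onBlock V (fun l => .const (if t l then 1 else 0)) .var)

variable {U V}

/-- The constant operands read the label substitution `labSubst` (the entries of `matOf U V`).
[cite: ChatterjeeTengse2023, Def. 2.27 (v1: Def. 34)] -/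
theorem bitOps_eval (s t : Fin (3 * L) → Bool) (v : τ) (ws : List (MvPolynomial τ k)) :
    (bitOps (k := k) U V s t v).eval ws = labSubst (k := k) U V s t v := by
  unfold bitOps labSubst onBlock
  split_ifs with h1 h2
  · cases s (Fin.find _ h1) <;> simp [ArithCircuit.Operand.eval, bit]
  · cases t (Fin.find _ h2) <;> simp [ArithCircuit.Operand.eval, bit]
  · rfl

/-- The constant operands `0/1` have sign constants. [cite: ChatterjeeTengse2023, Def. 2.2 (v1: Def. 10)] -/
theorem bitOps_hasSignConstants (s t : Fin (3 * L) → Bool) (v : τ) :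
    (bitOps (k := k) U V s t v).HasSignConstants := by
  have hb : ∀ b : Bool, (ArithCircuit.Operand.const (if b then (1 : k) else 0) :
      ArithCircuit.Operand k τ).HasSignConstants := by
    intro b; cases b
    · exact Or.inl rfl
    · exact Or.inr (Or.inl rfl)
  unfold bitOps onBlock
  split_ifs
  · exact hb _
  · exact hb _
  · trivial

omit [DecidableEq τ] in
/-- `vars (X n) ⊆ {n}` without a nontriviality assumption. [folklore] -/
private theorem notMem_vars_X' {w v : τ} (h : v ≠ w) : w ∉ (X v : MvPolynomial τ k).vars := by
  classical
  intro hv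
  rw [MvPolynomial.vars_def, Multiset.mem_toFinset] at hv
  exact h (Multiset.mem_singleton.1 (Multiset.mem_of_le (degrees_X' v) hv)).symm

omit [DecidableEq τ] in
/-- A bit has no variables. [folklore] -/
private theorem notMem_vars_bit {w : τ} (b : Bool) : w ∉ (bit b : MvPolynomial τ k).vars := by
  unfold bit
  cases b
  · simp
  · rw [if_pos rfl, ← MvPolynomial.C_1, MvPolynomial.vars_C]; exact Finset.notMem_empty w

/-- Substituting label bits commutes with the projections of a circuit projecting no label
variable. [cite: ChatterjeeTengse2023, Claim 2.31 (v1: Claim 38; p0013.txt:L9–L26)] -/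
theorem substCompat_labSubst {Q : ProjCircuit k τ} (s t : Fin (3 * L) → Bool)
    (hQ : ∀ i ∈ Q.projVars, (∀ l, U l ≠ i) ∧ ∀ l, V l ≠ i) :
    Q.SubstCompat id (labSubst (k := k) U V s t) := by
  refine ProjCircuit.substCompat_of_vars Q (fun i hi => ?_) (fun i hi i' hi' => ?_)
  · rw [labSubst, onBlock_of_ne (hQ i hi).1, onBlock_of_ne (hQ i hi).2]; rfl
  · change i ∉ (onBlock U (fun l => (bit (s l) : MvPolynomial τ k)) (onBlock V (fun l => bit (t l)) X) i').vars
    unfold onBlock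
    split_ifs
    · exact notMem_vars_bit _
    · exact notMem_vars_bit _
    · exact notMem_vars_X' hi'

/-! ### Prop. 2.29: the determinant of an explicit matrix by a small projection circuit -/

variable {r c : Fin L → τ} {ws : Fin K → Fin (3 * L) → τ} {zs : Fin K → τ} {μ₁ μ₂ : τ}
  {E : MvPolynomial τ k}

/-- **`D_L(x, s, t) = det M`**: the `L`-fold squaring of the program's encoder, evaluated at the
bits of the source and sink labels, is the determinant of the encoded matrix
("`C'(x) = D_k(x, s, t)` … computes the polynomial we need").
[cite: ChatterjeeTengse2023, Claim 2.31 (v1: Claim 38; p0013.txt:L6–L7, L26)] -/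
theorem labSubst_powPoly_mvEdge (hL : 0 < L) (hK : L ≤ K) (F : MVFresh r c U V) (S : Supply U V ws zs)
    (hEU : ∀ v ∈ E.vars, (∀ l, U l ≠ v) ∧ ∀ l, V l ≠ v)
    (hEw : ∀ i l, ws i l ∉ E.vars) (hEz : ∀ i, zs i ∉ E.vars) :
    aeval (labSubst (k := k) U V (srcLab L) (snkLab L)) (powPoly U V ws zs (mvEdge r c E U V) L) =
      (matOf r c E).det := by
  have hvw : ∀ i l, ws i l ∉ (mvEdge r c E U V).vars := fun i l =>
    notMem_vars_mvEdge (hEw i l) (fun l' => S.a_ne_ws l' i l) (fun l' => S.b_ne_ws l' i l)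
  have hvz : ∀ i, zs i ∉ (mvEdge r c E U V).vars := fun i =>
    notMem_vars_mvEdge (hEz i) (fun l' => S.a_ne_zs l' i) (fun l' => S.b_ne_zs l' i)
  change matOf U V (powPoly U V ws zs (mvEdge r c E U V) L) (srcLab L) (snkLab L) = _
  rw [matOf_powPoly S hvw hvz hK, matOf_mvEdge_pow_apply_src_snk hL F hEU le_rfl]

/-- **CT23 Prop. 2.29 (v1 Prop. 36) AS PRINTED, PROVED — encoder with ARBITRARY constants, the
constant-free clause as the printed "moreover": the determinant of an explicitly encoded
`2^L × 2^L` matrix is computed by a fan-in-two circuit with projection gates of size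
`≤ 2·size(C) + (145·L² + 256·L + 49)` — the printed `O(size(C) + log² N)` — which projects only
`C`'s bound variables and the squaring workspace, and which is constant-free (sign constants)
whenever `C` is** ("Moreover, if `C` is constant-free, then so is `C'`": `C`'s gates are copied
with their constants, and the construction adds only the gadget template, the squaring levels and
the label bits, all with constants `0, ±1`). Hypotheses: `K ≥ L` squaring levels of workspace;
all blocks distinct (`DetSupply`); `E` mentions no label/workspace variable; `C` computes `E` and
its projection gates bind none of `r, c, U, V, ws, zs` (the printed encoder has no projection
gates at all). ERRATUM (val-lit t24 g10, referee rows np 1357 / 1370): the first accepted text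
(`exists_projCircuit_det_matOf`, now a corollary of this theorem) stated only the constant-free
case, taking `C.HasSignConstants` as a hypothesis where the source has an implication; corrected
here, no construction changed.
[cite: ChatterjeeTengse2023, Prop. 2.29 (v1: Prop. 36; p0012.txt:L17–L28, p0013.txt:L26–L28)] -/
theorem exists_projCircuit_det_matOf_general (hL : 0 < L) (hK : L ≤ K)
    (D : DetSupply r c U V ws zs μ₁ μ₂)
    (hEU : ∀ v ∈ E.vars, (∀ l, U l ≠ v) ∧ ∀ l, V l ≠ v)
    (hEw : ∀ i l, ws i l ∉ E.vars) (hEz : ∀ i, zs i ∉ E.vars)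
    {C : ProjCircuit k τ} (h2 : C.IsFanInTwo) (hCE : C.Computes E)
    (hC : ∀ i ∈ C.projVars, (∀ l, r l ≠ i) ∧ (∀ l, c l ≠ i) ∧ (∀ l, U l ≠ i) ∧ (∀ l, V l ≠ i) ∧
      (∀ j l, ws j l ≠ i) ∧ ∀ j, zs j ≠ i) :
    ∃ Q : ProjCircuit k τ, Q.IsFanInTwo ∧ (C.HasSignConstants → Q.HasSignConstants) ∧
      Q.Computes (matOf r c E).det ∧
      Q.size ≤ 2 * C.size + (145 * L ^ 2 + 256 * L + 49) ∧
      Q.projVars ⊆ C.projVars ∪ {v | (∃ (i : Fin K) (l : Fin (3 * L)), ws i l = v) ∨ ∃ i : Fin K, zs i = v} := by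
  have F := D.mvFresh
  have S := D.supply
  -- brick E-d: the encoder circuit of the program's adjacency matrix (any constants)
  obtain ⟨Qmv, hmv2, hmvsc, hmvE, hmvsz, hmvproj⟩ :=
    exists_projCircuit_mvEdge_general F D.μ_ne D.U_ne_μ D.V_ne_μ h2 hCE
      (fun i hi => ⟨(hC i hi).1, (hC i hi).2.1, (hC i hi).2.2.1, (hC i hi).2.2.2.1⟩)
  -- brick E-c′: `L` squaring levels
  have hmvC : ∀ v ∈ Qmv.projVars,
      (∀ l, U l ≠ v) ∧ (∀ l, V l ≠ v) ∧ (∀ i l, ws i l ≠ v) ∧ ∀ i, zs i ≠ v := fun v hv =>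
    ⟨(hC v (hmvproj hv)).2.2.1, (hC v (hmvproj hv)).2.2.2.1, (hC v (hmvproj hv)).2.2.2.2.1,
      (hC v (hmvproj hv)).2.2.2.2.2⟩
  set QD := powCircuit U V ws zs Qmv L with hQD
  have hQDev : QD.eval = powPoly U V ws zs (mvEdge r c E U V) L := eval_powCircuit S hmvE hmvC hK
  have hQD2 : QD.IsFanInTwo := isFanInTwo_powCircuit hmv2 L
  have hQDsc : C.HasSignConstants → QD.HasSignConstants := fun hsc =>
    hasSignConstants_powCircuit (hmvsc hsc) L
  have hQDsz : QD.size = Qmv.size + L * (11 * (3 * L) + 3) := size_powCircuit Qmv hK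
  have hQDproj := projVars_powCircuit_subset (a := U) (b := V) (ws := ws) (zs := zs) Qmv L
  -- substitute the bits of the source and sink labels
  have hQDC : ∀ i ∈ QD.projVars, (∀ l, U l ≠ i) ∧ ∀ l, V l ≠ i := by
    intro i hi
    rcases hQDproj hi with hi | ⟨j, l, -, rfl⟩ | ⟨j, -, rfl⟩
    · exact ⟨(hmvC i hi).1, (hmvC i hi).2.1⟩
    · exact ⟨fun l' => S.a_ne_ws l' j l, fun l' => S.b_ne_ws l' j l⟩
    · exact ⟨fun l' => S.a_ne_zs l' j, fun l' => S.b_ne_zs l' j⟩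
  refine ⟨QD.subst [] id (bitOps (k := k) U V (srcLab L) (snkLab L)), ?_, ?_, ?_, ?_, ?_⟩
  · exact ProjCircuit.isFanInTwo_subst hQD2 (by simp) _ _
  · -- the printed "moreover": the label bits are the constants `0/1`
    exact fun hsc =>
      ProjCircuit.hasSignConstants_subst (hQDsc hsc) (by simp) _ (bitOps_hasSignConstants _ _)
  · change (QD.subst [] id _).eval = (matOf r c E).det
    rw [ProjCircuit.eval_subst QD [] (fun v _ => bitOps_eval (srcLab L) (snkLab L) v _)
      (substCompat_labSubst (srcLab L) (snkLab L) hQDC), hQDev]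
    exact labSubst_powPoly_mvEdge hL hK F S hEU hEw hEz
  · rw [ProjCircuit.size_subst, List.length_nil, zero_add, hQDsz]
    have : L * (11 * (3 * L) + 3) = 33 * L ^ 2 + 3 * L := by ring
    rw [this]
    omega
  · intro i hi
    rcases projVars_subst_subset QD [] _ hi with ⟨_, _, h⟩ | hi
    · simp at h
    · rcases hQDproj hi with hi | ⟨j, l, -, h⟩ | ⟨j, -, h⟩
      · exact Or.inl (hmvproj hi)
      · exact Or.inr (Or.inl ⟨j, l, h⟩)
      · exact Or.inr (Or.inr ⟨j, h⟩)

/-- **CT23 Prop. 2.29 (v1 Prop. 36), constant-free case** (the first accepted statement, kept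
verbatim; now the specialisation of `exists_projCircuit_det_matOf_general` to a constant-free
encoder `C`): a constant-free fan-in-two circuit with projection gates of size
`≤ 2·size(C) + (145·L² + 256·L + 49)` computing `det (matOf r c E)`, projecting only `C`'s bound
variables and the squaring workspace.
[cite: ChatterjeeTengse2023, Prop. 2.29 (v1: Prop. 36; p0012.txt:L17–L28, p0013.txt:L26–L28)] -/
theorem exists_projCircuit_det_matOf (hL : 0 < L) (hK : L ≤ K)
    (D : DetSupply r c U V ws zs μ₁ μ₂)
    (hEU : ∀ v ∈ E.vars, (∀ l, U l ≠ v) ∧ ∀ l, V l ≠ v)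
    (hEw : ∀ i l, ws i l ∉ E.vars) (hEz : ∀ i, zs i ∉ E.vars)
    {C : ProjCircuit k τ} (h2 : C.IsFanInTwo) (hsc : C.HasSignConstants) (hCE : C.Computes E)
    (hC : ∀ i ∈ C.projVars, (∀ l, r l ≠ i) ∧ (∀ l, c l ≠ i) ∧ (∀ l, U l ≠ i) ∧ (∀ l, V l ≠ i) ∧
      (∀ j l, ws j l ≠ i) ∧ ∀ j, zs j ≠ i) :
    ∃ Q : ProjCircuit k τ, Q.IsFanInTwo ∧ Q.HasSignConstants ∧ Q.Computes (matOf r c E).det ∧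
      Q.size ≤ 2 * C.size + (145 * L ^ 2 + 256 * L + 49) ∧
      Q.projVars ⊆ C.projVars ∪ {v | (∃ (i : Fin K) (l : Fin (3 * L)), ws i l = v) ∨ ∃ i : Fin K, zs i = v} := by
  obtain ⟨Q, hQ2, hQsc, hQE, hQsz, hQproj⟩ :=
    exists_projCircuit_det_matOf_general hL hK D hEU hEw hEz h2 hCE hC
  exact ⟨Q, hQ2, hQsc hsc, hQE, hQsz, hQproj⟩

end Literature.Barriers.ValiantsHypothesis
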